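import Mathlib.Analysis.SpecialFunctions.Pow.Real
import Mathlib.Analysis.SpecificLimits.Basic
import HarnessLib

/-!
# NE7HolderConstantsArith — the REAL ARITHMETIC behind the k-uniformity of the (9)-type Hölder constants (row NE7, gen 111): at level `k` of the tower
# (`M = L^k`, spacing `η = M⁻¹`, plaquette radius `a = ε∕M²`, flux-gradient bound `b = C·ε·(1+k)∕M³` — the (10)-log) the three constants of F4b's letter at
# `d = 4`, `R₀ = 6`, `R = 100` are `≤ a₀ε`, `≤ a₁ε`, `≤ a₂(β)ε` uniformly in `k`, for every `β < 1`; the one non-trivial input is the GEOMETRIC LETTER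
# `(1+k)·x^k ≤ (1 − x)⁻¹` at `x = L^{β−1} < 1`, i.e. `(1+k)·M^{β−1} ≤ (1 − L^{β−1})⁻¹` — the logarithm of the (10)-log bound is beaten by the spare factor `M^{1−β}`
# (and is NOT beaten at `β = 1`: print's `B₄(β₀) ↑ ∞`, cell GAPS C-B8-18; kit j342950)

Cell `pub-balaban`, rung (B)+1 sub-cell t4, lineage `b2b-balaban-t4-ne7-p1` (CRUX PROVER NE7 #1 = OWNER of BINDER row NE7), generation 111.  Memo
`t4/b2b-balaban-t4-ne7-p1-g111/ROAD-G111.md`.  File F5a of the line «(9)-TYPE k-UNIFORM HÖLDER REGULARITY OF EVERY CONSTRAINED SMALL-FIELD MINIMISER, every β < 1»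
(ROAD-G110 §NEXT (N2)); consumed by F5b `NE7AllMinimisersHolderRegGeneric`.
WHAT ([folklore]; 0 def, 0 sorry; Mathlib only).  §1 `succ_mul_pow_le` (`(1+k)x^k ≤ (1−x)⁻¹`), `succ_mul_rpow_le` (`(1+k)·(L^k)^{β−1} ≤ (1 − L^{β−1})⁻¹`); §2 `M2_le`
(the second-difference constant `2σ + 4δ²` of F4b at `d = 4`, `R = 100` is `≤ K₁(C)·p₁ + 6464·ab + K₂·a²` — NO pure `a` term); §3 **`holder_constants_le`**
(the three constants `≤ a₀ε, a₁(C)ε, a₂(C, G)ε`).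
HONEST FRAMING (page 1): real arithmetic; nothing of Bałaban's asserted; NOT NE3∕NE7 as spine nodes; spine 0∕9; finite T⁴ rung (B)+1 — NOT infinite volume, NOT mass gap,
NOT BetaPertH, NOT Clay.
-/

set_option autoImplicit false

namespace Summit.QuantumFields.BalabanUV.T4Continuum.NE7HolderConstantsArith

open Finset

/-! ## §1 The geometric letter -/

/-- `(1 + k)·x^k ≤ (1 − x)⁻¹` for `0 ≤ x < 1` (`x^k ≤ x^i` for `i ≤ k`, and `Σ_{i ≤ k} x^i ≤ (1 − x)⁻¹`). [folklore] -/
theorem succ_mul_pow_le {x : ℝ} (hx0 : 0 ≤ x) (hx1 : x < 1) (k : ℕ) : (1 + (k : ℝ)) * x ^ k ≤ (1 - x)⁻¹ := by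
  have h1 : (1 + (k : ℝ)) * x ^ k = ∑ _i ∈ Finset.range (k + 1), x ^ k := by
    rw [Finset.sum_const, Finset.card_range, nsmul_eq_mul]; push_cast; ring
  have h2 : ∑ _i ∈ Finset.range (k + 1), x ^ k ≤ ∑ i ∈ Finset.range (k + 1), x ^ i :=
    Finset.sum_le_sum fun i hi => pow_le_pow_of_le_one hx0 hx1.le (by rw [Finset.mem_range] at hi; omega)
  have h3 : ∑ i ∈ Finset.range (k + 1), x ^ i ≤ (1 - x)⁻¹ := by
    have hs := summable_geometric_of_lt_one hx0 hx1
    have := hs.sum_le_tsum (Finset.range (k + 1)) (fun i _ => pow_nonneg hx0 i)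
    rwa [tsum_geometric_of_lt_one hx0 hx1] at this
  rw [h1]; exact h2.trans h3

/-- **THE GEOMETRIC LETTER AT THE TOWER's SCALE**: for `1 < L`, `β < 1` and `M = L^k`: `(1 + k)·M^{β − 1} ≤ (1 − L^{β−1})⁻¹`, with `0 < 1 − L^{β−1}`. [folklore] -/
theorem succ_mul_rpow_le {L β : ℝ} (hL : 1 < L) (hβ1 : β < 1) (k : ℕ) :
    0 < 1 - L ^ (β - 1) ∧ (1 + (k : ℝ)) * (L ^ k) ^ (β - 1) ≤ (1 - L ^ (β - 1))⁻¹ := by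
  have hL0 : 0 < L := by linarith
  have hx0 : 0 ≤ L ^ (β - 1) := Real.rpow_nonneg hL0.le _
  have hx1 : L ^ (β - 1) < 1 := Real.rpow_lt_one_of_one_lt_of_neg hL (by linarith)
  refine ⟨by linarith, ?_⟩
  have e : (L ^ k) ^ (β - 1) = (L ^ (β - 1)) ^ k := by
    rw [← Real.rpow_natCast L k, ← Real.rpow_mul hL0.le, mul_comm, Real.rpow_mul hL0.le, Real.rpow_natCast]
  rw [e]
  exact succ_mul_pow_le hx0 hx1 k

/-! ## §2 The second-difference constant has no pure `a` term -/

/-- **`2σ + 4δ² ≤ K₁·p₁ + 6464·ab + 653024·a²`** at `d = 4`, `R = 100` (`p₁ = 2b + 2(101a)a`, `δ = 4(101p₁ + a)`, `σ = 4(100(2p₁ + 2p₁δ) + p₁ + aδ)`), for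
`0 ≤ a ≤ 1`, `0 ≤ b ≤ B₀`: `K₁ = 8(201 + 200D₀) + 8·404²·P₀` with `P₀ = 2B₀ + 202`, `D₀ = 4(101P₀ + 1)`. [folklore] -/
theorem M2_le {a b B₀ : ℝ} (ha0 : 0 ≤ a) (ha1 : a ≤ 1) (hb0 : 0 ≤ b) (hbB : b ≤ B₀) :
    2 * (4 * (100 * (2 * (2 * b + 2 * (101 * a) * a) + 2 * (2 * b + 2 * (101 * a) * a) * (4 * (101 * (2 * b + 2 * (101 * a) * a) + a)))
          + ((2 * b + 2 * (101 * a) * a) + a * (4 * (101 * (2 * b + 2 * (101 * a) * a) + a)))))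
      + 4 * (4 * (101 * (2 * b + 2 * (101 * a) * a) + a)) ^ 2
    ≤ (8 * (201 + 200 * (4 * (101 * (2 * B₀ + 202) + 1))) + 8 * 404 ^ 2 * (2 * B₀ + 202)) * (2 * b + 2 * (101 * a) * a)
      + 6464 * (a * b) + 653024 * a ^ 2 := by
  set p : ℝ := 2 * b + 2 * (101 * a) * a with hp
  set δ : ℝ := 4 * (101 * p + a) with hδ
  set P₀ : ℝ := 2 * B₀ + 202 with hP₀
  set D₀ : ℝ := 4 * (101 * P₀ + 1) with hD₀
  have hp0 : 0 ≤ p := by positivity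
  have haa : a * a ≤ 1 := by nlinarith
  have hpP : p ≤ P₀ := by rw [hp, hP₀]; nlinarith
  have hP0 : 0 ≤ P₀ := hp0.trans hpP
  have hδ0 : 0 ≤ δ := by positivity
  have hδD : δ ≤ D₀ := by rw [hδ, hD₀]; nlinarith
  -- `σ ≤ 4(201 + 200D₀)p + 4aδ`, `aδ = 404ap + 4a² = 808ab + 81608a³ + 4a² ≤ 808ab + 81612a²`
  have h1 : 200 * p * δ ≤ 200 * D₀ * p := by nlinarith [mul_le_mul_of_nonneg_left hδD (by positivity : (0 : ℝ) ≤ 200 * p)]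
  have ha3 : a ^ 3 ≤ a ^ 2 := by nlinarith [sq_nonneg a]
  have h2 : a * δ ≤ 808 * (a * b) + 81612 * a ^ 2 := by
    have e : a * δ = 808 * (a * b) + 81608 * a ^ 3 + 4 * a ^ 2 := by rw [hδ, hp]; ring
    rw [e]; nlinarith
  -- `δ² ≤ 2(404²p² + 16a²) ≤ 2·404²·P₀·p + 32a²`
  have h3 : δ ^ 2 ≤ 2 * (404 ^ 2 * p ^ 2 + 16 * a ^ 2) := by
    have e : δ = 404 * p + 4 * a := by rw [hδ]; ring
    rw [e]; nlinarith [sq_nonneg (404 * p - 4 * a)]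
  have h4 : p ^ 2 ≤ P₀ * p := by nlinarith
  nlinarith

/-! ## §3 The three constants at the tower's scales -/

/-- **THE k-UNIFORM HÖLDER CONSTANTS.**  At `M ≥ 1` with `1 + k ≤ M`, `0 < ε ≤ 1`, `0 ≤ C`, `a = ε∕M²`, `b = Cε(1+k)∕M³`, `η = M⁻¹`, `β ≤ 1`, and the geometric
letter `(1+k)M^{β−1} ≤ G`: the constants of F4b's letter at `d = 4`, `R₀ = 6`, `R = 100` obey
`200a∕η ≤ 200ε`, `2(4(100(2b + 2(100a)a) + a))∕η² ≤ 8(200C + 20001)ε`, `12(2σ + 4δ²)∕(η²η^β) ≤ a₂(C, G)ε`; and `103a ≤ 103ε`, `a ≤ ε`. [folklore] -/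
theorem holder_constants_le {ε M C G β kk : ℝ} (hε : 0 < ε) (hε1 : ε ≤ 1) (hM : 1 ≤ M) (hkk1 : 1 ≤ kk) (hkkM : kk ≤ M) (hC : 0 ≤ C)
    (hβ1 : β ≤ 1) (hG : kk * M ^ (β - 1) ≤ G) :
    200 * (ε / M ^ 2) / M⁻¹ ≤ 200 * ε ∧
    2 * (4 * (100 * (2 * (C * ε * kk / M ^ 3) + 2 * (100 * (ε / M ^ 2)) * (ε / M ^ 2)) + ε / M ^ 2)) / M⁻¹ ^ 2 ≤ 8 * (200 * C + 20001) * ε ∧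
    2 * 6 * (2 * (4 * (100 * (2 * (2 * (C * ε * kk / M ^ 3) + 2 * (101 * (ε / M ^ 2)) * (ε / M ^ 2))
          + 2 * (2 * (C * ε * kk / M ^ 3) + 2 * (101 * (ε / M ^ 2)) * (ε / M ^ 2))
            * (4 * (101 * (2 * (C * ε * kk / M ^ 3) + 2 * (101 * (ε / M ^ 2)) * (ε / M ^ 2)) + ε / M ^ 2)))
          + ((2 * (C * ε * kk / M ^ 3) + 2 * (101 * (ε / M ^ 2)) * (ε / M ^ 2))
            + ε / M ^ 2 * (4 * (101 * (2 * (C * ε * kk / M ^ 3) + 2 * (101 * (ε / M ^ 2)) * (ε / M ^ 2)) + ε / M ^ 2)))))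
        + 4 * (4 * (101 * (2 * (C * ε * kk / M ^ 3) + 2 * (101 * (ε / M ^ 2)) * (ε / M ^ 2)) + ε / M ^ 2)) ^ 2)
        / (M⁻¹ ^ 2 * M⁻¹ ^ β)
      ≤ 12 * ((8 * (201 + 200 * (4 * (101 * (2 * C + 202) + 1))) + 8 * 404 ^ 2 * (2 * C + 202)) * (2 * C * G + 202) + 6464 * C + 653024) * ε := by
  have hM0 : 0 < M := by linarith
  set a : ℝ := ε / M ^ 2 with ha
  set b : ℝ := C * ε * kk / M ^ 3 with hb
  have ha0 : 0 ≤ a := by positivity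
  have hb0 : 0 ≤ b := by positivity
  have hM2 : 1 ≤ M ^ 2 := one_le_pow₀ hM
  have hM3 : 1 ≤ M ^ 3 := one_le_pow₀ hM
  have haε : a ≤ ε := by rw [ha]; exact div_le_self hε.le hM2
  have ha1 : a ≤ 1 := haε.trans hε1
  have hkM3 : kk / M ^ 3 ≤ 1 := by
    rw [div_le_one (by positivity)]
    calc kk ≤ M := hkkM
      _ ≤ M ^ 3 := by nlinarith
  have hbC : b ≤ C := by
    rw [hb]
    calc C * ε * kk / M ^ 3 = C * ε * (kk / M ^ 3) := by ring
      _ ≤ C * 1 * 1 := by gcongr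
      _ = C := by ring
  have hbCε : b ≤ C * ε := by
    rw [hb]
    calc C * ε * kk / M ^ 3 = C * ε * (kk / M ^ 3) := by ring
      _ ≤ C * ε * 1 := by gcongr
      _ = C * ε := by ring
  refine ⟨?_, ?_, ?_⟩
  · -- `200a/η = 200ε/M ≤ 200ε`
    have e : 200 * (ε / M ^ 2) / M⁻¹ = 200 * (ε / M) := by field_simp
    rw [ha, e]
    exact mul_le_mul_of_nonneg_left (div_le_self hε.le hM) (by norm_num)
  · -- `η⁻²·(…) = M²·(…)`: `200b·M² = 200Cε(kk/M) ≤ 200Cε`, `20000a²M² = 20000ε²/M² ≤ 20000ε`, `aM² = ε`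
    have e1 : 2 * (4 * (100 * (2 * b + 2 * (100 * a) * a) + a)) / M⁻¹ ^ 2
        = 1600 * (b * M ^ 2) + 160000 * (a * a * M ^ 2) + 8 * (a * M ^ 2) := by
      field_simp; ring
    rw [e1]
    have t1 : b * M ^ 2 ≤ C * ε := by
      rw [hb]
      have e : C * ε * kk / M ^ 3 * M ^ 2 = C * ε * (kk / M) := by field_simp
      rw [e]
      have : kk / M ≤ 1 := by rw [div_le_one hM0]; exact hkkM
      calc C * ε * (kk / M) ≤ C * ε * 1 := by gcongr
        _ = C * ε := mul_one _
    have t2 : a * a * M ^ 2 ≤ ε := by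
      rw [ha]
      have e : ε / M ^ 2 * (ε / M ^ 2) * M ^ 2 = ε * (ε / M ^ 2) := by field_simp
      rw [e]; nlinarith
    have t3 : a * M ^ 2 = ε := by rw [ha]; field_simp
    rw [t3]; nlinarith
  · -- the Hölder constant
    have hM2' := M2_le ha0 ha1 hb0 hbC
    have hK : 0 ≤ (8 * (201 + 200 * (4 * (101 * (2 * C + 202) + 1))) + 8 * 404 ^ 2 * (2 * C + 202) : ℝ) := by positivity
    have hMβ : 0 < M ^ β := Real.rpow_pos_of_pos hM0 β
    have hη : M⁻¹ ^ 2 * M⁻¹ ^ β = (M ^ 2 * M ^ β)⁻¹ := by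
      rw [Real.inv_rpow hM0.le, mul_inv, inv_pow]
    rw [hη, div_inv_eq_mul]
    have hMβ1 : M ^ (β - 1) = M ^ β / M := Real.rpow_sub_one hM0.ne' β
    have hMβM : M ^ β ≤ M := by
      have h := Real.rpow_le_rpow_of_exponent_le hM hβ1
      rwa [Real.rpow_one] at h
    -- the scale gains
    have g1 : b * (M ^ 2 * M ^ β) ≤ C * ε * G := by
      have e : b * (M ^ 2 * M ^ β) = C * ε * (kk * M ^ (β - 1)) := by
        rw [hb, hMβ1]; field_simp
      rw [e]; exact mul_le_mul_of_nonneg_left hG (by positivity)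
    have g2 : a * a * (M ^ 2 * M ^ β) ≤ ε := by
      have e : a * a * (M ^ 2 * M ^ β) = ε * ε * (M ^ β / M ^ 2) := by rw [ha]; field_simp
      rw [e]
      have h1 : M ^ β / M ^ 2 ≤ 1 := by rw [div_le_one (by positivity)]; nlinarith
      nlinarith [mul_le_mul_of_nonneg_left h1 (by positivity : 0 ≤ ε * ε)]
    have g3 : a * b * (M ^ 2 * M ^ β) ≤ C * ε := by
      have e : a * b * (M ^ 2 * M ^ β) = C * ε * ε * (kk * M ^ β / M ^ 3) := by rw [ha, hb]; field_simp
      rw [e]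
      have h1 : kk * M ^ β / M ^ 3 ≤ 1 := by
        rw [div_le_one (by positivity)]
        have h2 : kk * M ^ β ≤ M * M := mul_le_mul hkkM hMβM hMβ.le (by linarith)
        nlinarith
      calc C * ε * ε * (kk * M ^ β / M ^ 3) ≤ C * ε * ε * 1 := mul_le_mul_of_nonneg_left h1 (by positivity)
        _ = (C * ε) * ε := by ring
        _ ≤ (C * ε) * 1 := mul_le_mul_of_nonneg_left hε1 (by positivity)
        _ = C * ε := mul_one _
    have step1 := mul_le_mul_of_nonneg_right (mul_le_mul_of_nonneg_left hM2' (by norm_num : (0 : ℝ) ≤ 2 * 6)) (by positivity : 0 ≤ M ^ 2 * M ^ β)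
    refine step1.trans ?_
    have expand : 2 * 6 * ((8 * (201 + 200 * (4 * (101 * (2 * C + 202) + 1))) + 8 * 404 ^ 2 * (2 * C + 202)) * (2 * b + 2 * (101 * a) * a)
          + 6464 * (a * b) + 653024 * a ^ 2) * (M ^ 2 * M ^ β)
        = 12 * ((8 * (201 + 200 * (4 * (101 * (2 * C + 202) + 1))) + 8 * 404 ^ 2 * (2 * C + 202))
            * (2 * (b * (M ^ 2 * M ^ β)) + 202 * (a * a * (M ^ 2 * M ^ β)))
          + 6464 * (a * b * (M ^ 2 * M ^ β)) + 653024 * (a * a * (M ^ 2 * M ^ β))) := by ring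
    rw [expand]
    have k1 := mul_le_mul_of_nonneg_left g1 hK
    have k2 := mul_le_mul_of_nonneg_left g2 hK
    linarith [k1, k2, g3, g2]

end Summit.QuantumFields.BalabanUV.T4Continuum.NE7HolderConstantsArith
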